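import Summits.NavierStokesRegularity.NavierStokesRegularity.Theses.SelfMixingDichotomy
import Summits.NavierStokesRegularity.NavierStokesRegularity.Theorems.SelfMixingDichotomyMixingPayoffWindowRegularity
import Summits.NavierStokesRegularity.NavierStokesRegularity.Theorems.SelfMixingDichotomyMixingPayoffAdvectionDiffusionSchwartz
import Summits.NavierStokesRegularity.NavierStokesRegularity.Theorems.SelfMixingDichotomyMixingPayoffAdmissibleDriftHeatClass
import Summits.NavierStokesRegularity.NavierStokesRegularity.Theorems.SelfMixingDichotomyMixingPayoffAdmissibleMinPrinciple
import Summits.NavierStokesRegularity.NavierStokesRegularity.Theorems.SelfMixingDichotomyMixingPayoffDriftHeatBumpFloor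
import Summits.NavierStokesRegularity.NavierStokesRegularity.Theorems.SelfMixingDichotomyMixingPayoffTypeIFloorAssembly
import Literature.Analysis.FluidPDE.DissipatesAtScale
import Literature.Analysis.FluidPDE.DriftHeatLocalClass

/-!
# Skeleton (line `birth`, lead rev 4) for the crux `MixingPayoff` of route `SelfMixingDichotomy`

Crux item `stmt-NavierStokesRegularity-1422`, decl
`Summit.NavierStokesRegularity.NavierStokesRegularity.Theses.SelfMixingDichotomy.MixingPayoff` (P):
there is an absolute `δ > 0` such that for every classical Leray–Hopf solution `u` (`ν = 1`) on
`ℝ³ × [0,T)` from a rapidly decaying datum and every `x₀`, if the drift `u` dissipates scalars at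
every small parabolic scale about `(T, x₀)` with factor `δ` (`DissipatesAtScale u T x₀ r δ` for all
`r ∈ (0, r₀)`, the route's `MIX`), then `u` is bounded near `(T, x₀)` (`BDD`).

## The line (type split at the parabolic scale) — see `Lines/birth.md`

P is split along the local Type-I velocity bound `√(T - t) ‖u(t,x)‖ ≤ K` on a parabolic cylinder at
`(T, x₀)`:

* **W** (scalar well-posedness on the window) = `stub_windowRegularity` (W1: on a closed sub-slab
  `[a,b] ⊂ [0,T)` the velocity of a standing solution is jointly smooth with ALL space–time
  derivatives bounded — Tao 2011 closed-slab bounds, in tree and PROVED as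
  `tao2011_hasBoundedSobolevNormsOn_holds`, plus Sobolev and the projected equation for the time
  derivatives) + `stub_advectionDiffusionSchwartz` (W2: the textbook Cauchy problem for
  `∂ₜθ + v·∇θ = Δθ` with a `C_b^∞` drift and a `C_c^∞` datum has a jointly smooth solution all of
  whose derivatives decay rapidly, uniformly on the slab — Friedman 1964 Ch. 1 Thm 12, Ch. 9), glued
  by `scalarSlabWellposed` (proved here).
* **F** (bounded-drift floor under Type I) = `stub_admissibleDriftHeatClass` (F1: a MIX-admissible
  scalar with a drift bounded by `A` on `S × U` is a member of the tree's local drift–heat class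
  `IsDriftHeatSolutionOn a θ A S U` for some drift `a`) + `stub_admissibleMinPrinciple` (F2: the
  whole-space minimum principle for MIX-admissible scalars) + `stub_driftHeatBumpFloor` (F3: the
  quantitative Gaussian floor for the local class — a corollary of the PROVED
  `IsDriftHeatSolutionOn.kernel_lower_bound` with the explicit profiles of `DriftHeatGaussianBounds`)
  + `stub_typeIFloorAssembly` (F: Type-I(K) ⇒ drift bound `√2 K / r` on the window, the three pieces,
  and the `L²` accounting; held by the lead), glued by `typeIFloor` (proved here).
* **H** = `stub_mixingForcesTypeI` (the OPEN HEART of P, unchanged): cofinal `δ`-mixing at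
  `(T, x₀)` forces a Type-I(K) bound there. H ⇔ P modulo W + F (BDD ⇒ Type-I(K) for every K), so
  H carries exactly the open content of the crux; `EnergySupercriticality` bites H and only H.

All stub signatures are written in importable tree vocabulary (`Literature.Analysis.FluidPDE.*`,
Mathlib), never through the local abbreviations below, so that every stub can land verbatim as a
`Theorems/SelfMixingDichotomyMixingPayoff<Stub>.lean --supports` file.

Assembly: `mixingPayoff_of_WFH : W-sig → F-sig → H-sig → ⟨body of the crux, verbatim⟩` (sorry-free,
standard axioms; `δ* := min δ_H (c₁(K)/2)`, contradiction between `MIX(r, δ*)` and the floor on the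
scalar launched by W from the `ContDiffBump` datum), and
`MixingPayoff_of : MixingPayoff := mixingPayoff_of_WFH scalarSlabWellposed typeIFloor stub_mixingForcesTypeI`.

## Disproof used

No `Disproof.lean`, no `Negative/` lemmas, no dead lines on this crux at lead rev 1
(`ledger crux ls stmt-NavierStokesRegularity-1422`: `Lines/birth.lean`, `Lines/birth.md`, `PICKED.md`).
Honoured: the refuter's crux-attack facts (a) bounded-drift floor (= F), (b) Nash ceiling (the
assembly works at `δ* < c₁(K) < 1`), (c) mass export (consistency constraint `K ≳ δ^{-2/3}` on H).

Status (lead rev 3, 2026-08-17): W1, W2, F1, F2, F3 and the F-assembly have LANDED as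
`Theorems/SelfMixingDichotomyMixingPayoff{WindowRegularity,AdvectionDiffusionSchwartz,
AdmissibleDriftHeatClass,AdmissibleMinPrinciple,DriftHeatBumpFloor,TypeIFloorAssembly}.lean`
(p150592, p151515, p147302, p147244, p147465, p152612; all sorry-free, standard axioms) and are
imported below; the ONLY remaining `sorry` is the open heart `stub_mixingForcesTypeI` (H).
The skeleton is therefore a kernel-checked reduction `H → MixingPayoff`; the converse
`MixingPayoff → H` is elementary (BDD ⇒ Type-I(K) for every K), so H ⇔ P — LANDED as
`Theorems/SelfMixingDichotomyMixingPayoffReduction.lean` (`mixingPayoff_iff_mixingForcesTypeI`,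
p153393). Structural facts on H also landed: mass export (`mixingPayoff_massExport`, p155835:
`δ`-mixing at scale `r` forces `‖u‖ ≥ c δ^{-2/3}/r` on the window within `r δ^{-2/3}` of `x₀`) and
its corollaries (`…MassExportCorollaries.lean`: Type-I ratio `≥ c' δ^{-2/3}` in every cylinder at
a cofinally mixing point; regular points are never cofinally `δ`-mixing for `δ ≤ δ₀`; any `K` in H
satisfies `K ≥ c' δ^{-2/3}`). Lead's dossier on H: `Lines/birth-H-dossier.md`.
-/

noncomputable section

open scoped ContDiff
open MeasureTheory Set Function Metric

-- `Summit = Problem` for this summit; the tree sets `weak.linter.dupNamespace = false` in the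
-- lakefile, made explicit here for out-of-tree `lean check`.
set_option linter.dupNamespace false

namespace Summit.NavierStokesRegularity.NavierStokesRegularity.Cruxes.MixingPayoff.Birth

open Literature.Analysis.FluidPDE
open Summit.NavierStokesRegularity.NavierStokesRegularity.Theses.SelfMixingDichotomy (MixingPayoff)

local notation "E3" => EuclideanSpace ℝ (Fin 3)

/-! ## W — scalar well-posedness on the window -/

/-- **Stub W1 — regularity of the drift on a closed sub-slab (true; M/L).** For a standing
solution (`0 < T`, classical on `[0,T)`, Leray–Hopf from `u 0`, rapidly decaying datum) and
`0 ≤ a < b < T`, the velocity is jointly smooth on `[a,b] × ℝ³` and every space–time derivative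
of `uncurry u` (within `[a,b] × ℝ³`) is bounded there. Spatial derivatives: Tao 2011 closed-slab
bounds (`tao2011_hasBoundedSobolevNormsOn_holds`, PROVED; finite energy from
`IsLerayHopfOn.lintegral_enorm_sq_le`; `IsClassicalNSSolutionOn.mono` to `Icc 0 b`) and the
Sobolev imbedding (`linfty_bound_of_hasBoundedSobolevNormsOn_holds` applied to the derivative
fields); time and mixed derivatives: the projected equation `∂ₜu = P(Δu − (u·∇)u)` (Leray–Hopf
weak form + smoothness) iterated. Leans on: `IsClassicalNSSolutionOn`, `IsLerayHopfOn`,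
`HasRapidSpatialDecay`, `IsSmoothSpaceTimeOn`, `HasBoundedSobolevNormsOn`, Tao2011 (proved). -/
theorem stub_windowRegularity :
    ∀ (T : ℝ) (u : ℝ → E3 → E3) (p : ℝ → E3 → ℝ), 0 < T →
    IsClassicalNSSolutionOn (Set.Ico 0 T) 1 0 u p → IsLerayHopfOn T 1 0 (u 0) u →
    HasRapidSpatialDecay (u 0) →
    ∀ a b : ℝ, 0 ≤ a → a < b → b < T →
    IsSmoothSpaceTimeOn (Set.Icc a b) u ∧
    ∀ n : ℕ, ∃ C : ℝ, ∀ t ∈ Set.Icc a b, ∀ x : E3,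
      ‖iteratedFDerivWithin ℝ n (Function.uncurry u) (Set.Icc a b ×ˢ Set.univ) (t, x)‖ ≤ C :=
  Summit.NavierStokesRegularity.NavierStokesRegularity.Theorems.stub_windowRegularity

/-- **Stub W2 — the Cauchy problem for advection–diffusion with a `C_b^∞` drift in the
Schwartz-type class (textbook; XL to formalise, vendorable as a cited fact).** Let `a < b` and let
`v : ℝ → ℝ³ → ℝ³` be jointly smooth on `[a,b] × ℝ³` with all space–time derivatives bounded. Then
every `C_c^∞` datum `θ₀` launches a solution `θ` of `∂ₜθ + ⟪v, ∇θ⟫ = Δθ` on `[a,b] × ℝ³`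
(one-sided time derivative within `[a,b]`), jointly smooth, with Schwartz-type decay of all
space–time derivatives uniformly in `t ∈ [a,b]` (`HasUniformRapidDecayOn`), and `θ a = θ₀`.
Sources: Friedman 1964, *PDE of parabolic type*, Ch. 1 Thm 12 (existence for the Cauchy
problem), Thm 16 (uniqueness in the growth class), Ch. 9 Thms 2, 7 (Gaussian bounds for the
fundamental solution and its derivatives ⇒ decay); Ladyzhenskaya–Solonnikov–Ural'ceva IV §14.
Leans on: `IsSmoothSpaceTimeOn`, `HasUniformRapidDecayOn`, `timeDerivWithin`, Mathlib
`ContDiff`, `HasCompactSupport`, `gradient`, `Laplacian.laplacian`; tree heat-kernel machinery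
(`Literature.Analysis.UnboundedOperators.HeatKernel*`, `HeatExtension*`) for a proof. -/
theorem stub_advectionDiffusionSchwartz :
    ∀ (a b : ℝ), a < b → ∀ (v : ℝ → E3 → E3), IsSmoothSpaceTimeOn (Set.Icc a b) v →
    (∀ n : ℕ, ∃ C : ℝ, ∀ t ∈ Set.Icc a b, ∀ x : E3,
      ‖iteratedFDerivWithin ℝ n (Function.uncurry v) (Set.Icc a b ×ˢ Set.univ) (t, x)‖ ≤ C) →
    ∀ θ₀ : E3 → ℝ, ContDiff ℝ ∞ θ₀ → HasCompactSupport θ₀ →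
    ∃ θ : ℝ → E3 → ℝ, IsSmoothSpaceTimeOn (Set.Icc a b) θ ∧ HasUniformRapidDecayOn (Set.Icc a b) θ ∧
      (∀ t ∈ Set.Icc a b, ∀ x : E3,
        timeDerivWithin (Set.Icc a b) θ t x + inner ℝ (v t x) (gradient (θ t) x)
          = Laplacian.laplacian (θ t) x) ∧
      θ a = θ₀ :=
  Summit.NavierStokesRegularity.NavierStokesRegularity.Theorems.stub_advectionDiffusionSchwartz

/-- **W — well-posedness of the passive-scalar problem on the window** (`stub_scalarSlabWellposed`
of the birth skeleton, now PROVED from W1 + W2): for a standing solution and `0 < r`, `r² < T`,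
every `C_c^∞` datum launches a MIX-admissible scalar on `[T - r², T - r²/2]` starting from it. -/
theorem scalarSlabWellposed :
    ∀ (T : ℝ) (u : ℝ → E3 → E3) (p : ℝ → E3 → ℝ), 0 < T →
    IsClassicalNSSolutionOn (Set.Ico 0 T) 1 0 u p → IsLerayHopfOn T 1 0 (u 0) u →
    HasRapidSpatialDecay (u 0) →
    ∀ r : ℝ, 0 < r → r ^ 2 < T →
    ∀ θ₀ : E3 → ℝ, ContDiff ℝ ∞ θ₀ → HasCompactSupport θ₀ →
    ∃ θ : ℝ → E3 → ℝ,
      IsSmoothSpaceTimeOn (Set.Icc (T - r ^ 2) (T - r ^ 2 / 2)) θ ∧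
      HasUniformRapidDecayOn (Set.Icc (T - r ^ 2) (T - r ^ 2 / 2)) θ ∧
      (∀ t ∈ Set.Icc (T - r ^ 2) (T - r ^ 2 / 2), ∀ x : E3,
        timeDerivWithin (Set.Icc (T - r ^ 2) (T - r ^ 2 / 2)) θ t x + inner ℝ (u t x) (gradient (θ t) x)
          = Laplacian.laplacian (θ t) x) ∧
      θ (T - r ^ 2) = θ₀ := by
  intro T u p hT hcl hLH hdec r hr hrT θ₀ hθ₀ hθ₀c
  have ha : (0 : ℝ) ≤ T - r ^ 2 := by linarith
  have hab : T - r ^ 2 < T - r ^ 2 / 2 := by nlinarith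
  have hb : T - r ^ 2 / 2 < T := by nlinarith
  obtain ⟨hsm, hbd⟩ := stub_windowRegularity T u p hT hcl hLH hdec (T - r ^ 2) (T - r ^ 2 / 2) ha hab hb
  exact stub_advectionDiffusionSchwartz (T - r ^ 2) (T - r ^ 2 / 2) hab u hsm hbd θ₀ hθ₀ hθ₀c

/-! ## F — the bounded-drift floor under a Type-I bound -/

/-- **Stub F1 — MIX-admissible scalars belong to the local drift–heat class (true; M).** Let
`S = [T - r², T - r²/2]`, `0 < r`, let the drift `u` be continuous on `S × ℝ³` and bounded by `A`
on `S × U`, and let `θ` be jointly smooth on `S × ℝ³` solving `∂ₜθ + ⟪u, ∇θ⟫ = Δθ` pointwise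
(time derivative within `S`). Then for SOME drift `a` (e.g. `u` clamped in time to `S`, which is
globally measurable) `θ` is a member of `IsDriftHeatSolutionOn a θ A S U`
(`Literature/Analysis/FluidPDE/DriftHeatLocalClass`): slices `C²` on `U`, `(t,x) ↦ D(θ t) x` and
`(t,x) ↦ Δ(θ t) x` continuous on `S × U` (from `ContDiffOn` of `uncurry θ` on `S ×ˢ univ`,
`UniqueDiffOn`), and the time-integrated equation
`θ t x − θ s x = ∫ₛᵗ (Δ(θ τ) x − D(θ τ) x (a τ x)) dτ` (FTC for the one-sided derivative,
`⟪u, ∇θ⟫ = D θ (u)` by `InnerProductSpace.toDual_symm_apply`). Leans on: `IsSmoothSpaceTimeOn`,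
`timeDerivWithin`, `IsDriftHeatSolutionOn`, Mathlib `intervalIntegral` FTC
(`integral_eq_sub_of_hasDeriv_right_of_le`), `Set.projIcc`. -/
theorem stub_admissibleDriftHeatClass :
    ∀ (T r : ℝ) (u : ℝ → E3 → E3) (θ : ℝ → E3 → ℝ), 0 < r →
    ContinuousOn (Function.uncurry u) (Set.Icc (T - r ^ 2) (T - r ^ 2 / 2) ×ˢ Set.univ) →
    IsSmoothSpaceTimeOn (Set.Icc (T - r ^ 2) (T - r ^ 2 / 2)) θ →
    (∀ t ∈ Set.Icc (T - r ^ 2) (T - r ^ 2 / 2), ∀ x : E3,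
      timeDerivWithin (Set.Icc (T - r ^ 2) (T - r ^ 2 / 2)) θ t x + inner ℝ (u t x) (gradient (θ t) x)
        = Laplacian.laplacian (θ t) x) →
    ∀ (A : ℝ) (U : Set E3), (∀ t ∈ Set.Icc (T - r ^ 2) (T - r ^ 2 / 2), ∀ x ∈ U, ‖u t x‖ ≤ A) →
    ∃ a : ℝ → E3 → E3, IsDriftHeatSolutionOn a θ A (Set.Icc (T - r ^ 2) (T - r ^ 2 / 2)) U :=
  Summit.NavierStokesRegularity.NavierStokesRegularity.Theorems.stub_admissibleDriftHeatClass

/-- **Stub F2 — the whole-space minimum principle for MIX-admissible scalars (true; M).** Let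
`S = [T - r², T - r²/2]`, `0 < r`, and let `θ` be jointly smooth on `S × ℝ³` with uniform rapid
decay (`HasUniformRapidDecayOn`, so `θ(t,x) → 0` as `‖x‖ → ∞` uniformly in `t ∈ S`) solving
`∂ₜθ + ⟪u, ∇θ⟫ = Δθ` pointwise (ANY drift `u : ℝ → ℝ³ → ℝ³`, no hypothesis on it: at an interior
minimum `∇θ = 0` kills the drift term). If `θ(T - r²) ≥ 0` then `θ ≥ 0` on `S × ℝ³`. Proof:
for `ε > 0`, `w = θ + ε (t − (T − r²))` satisfies `∂ₜw + ⟪u,∇w⟫ − Δw = ε > 0`; a negative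
minimum of `w` over `S × ℝ³` exists by decay + compactness and sits at `t > T − r²`, where
`∇w = 0`, `Δw ≥ 0` (`IsLocalMax.laplacian_nonpos` of `ParabolicComparison` on `−w`),
`∂ₜw ≤ 0` (one-sided from the left) — contradiction; let `ε → 0`. Leans on:
`IsSmoothSpaceTimeOn`, `HasUniformRapidDecayOn`, `timeDerivWithin`,
`Literature.Analysis.FluidPDE.IsLocalMax.laplacian_nonpos`, Mathlib `IsCompact.exists_isMinOn`. -/
theorem stub_admissibleMinPrinciple :
    ∀ (T r : ℝ) (u : ℝ → E3 → E3) (θ : ℝ → E3 → ℝ), 0 < r →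
    IsSmoothSpaceTimeOn (Set.Icc (T - r ^ 2) (T - r ^ 2 / 2)) θ →
    HasUniformRapidDecayOn (Set.Icc (T - r ^ 2) (T - r ^ 2 / 2)) θ →
    (∀ t ∈ Set.Icc (T - r ^ 2) (T - r ^ 2 / 2), ∀ x : E3,
      timeDerivWithin (Set.Icc (T - r ^ 2) (T - r ^ 2 / 2)) θ t x + inner ℝ (u t x) (gradient (θ t) x)
        = Laplacian.laplacian (θ t) x) →
    (∀ x : E3, 0 ≤ θ (T - r ^ 2) x) →
    ∀ t ∈ Set.Icc (T - r ^ 2) (T - r ^ 2 / 2), ∀ x : E3, 0 ≤ θ t x :=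
  Summit.NavierStokesRegularity.NavierStokesRegularity.Theorems.stub_admissibleMinPrinciple

/-- **Stub F3 — the quantitative Gaussian floor for the local drift–heat class (true; M).** For
every `K > 0` there is `λ = λ(K) > 0` (e.g. `λ = (vol B₁ / 128) (2π)^{-3/2} e^{-1/2 - 10K - 2K²}`)
such that: if `θ ≥ 0` is a member of `IsDriftHeatSolutionOn a θ (√2 K / r) S U` on the window
`S = [T - r², T - r²/2]` over an open `U ⊇ B̄(x₀, (3 + 8K) r)`, and `θ(T - r²) = 1` on
`B̄(x₀, r/2)`, then `θ(T - r²/2) ≥ λ` on `B̄(x₀, r/2)`. Proof: `IsDriftHeatSolutionOn.kernel_lower_bound`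
(PROVED, `DriftHeatKernelLowerBound`) with centre `x₀`, `rs = re = r/2`, `ρ = (3 + 8K) r`,
`t_b = T − r²`, `t_T = t = T − r²/2`, weight `h` = the `ContDiffBump x₀` with `rIn = r/4`,
`rOut = r/2` (`∫ h ≥ vol B̄(x₀, r/4)`); room `2·3·(r²/2) < (ρ − rs)²`; at age `σ = r²/2`,
`dkTilt 3 (√2K/r) r σ ≤ 10K + 2K²`, so `kSubLow ≥ (2πr²)^{-3/2} e^{-1/2-10K-2K²}` while
`gaussTail 3 (ρ − rs) σ = (2πr²)^{-3/2} e^{-(2.5+8K)²/2} ≤ kSubLow / 2`; the powers of `r` cancel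
(`finrank_euclideanSpace_fin`, `Measure.addHaar_closedBall`). Leans on:
`IsDriftHeatSolutionOn.kernel_lower_bound`, `kSubLow`, `gaussTail`, `dkTilt`
(`DriftHeatGaussianBounds`), Mathlib `ContDiffBump`, `Real.rpow`. -/
theorem stub_driftHeatBumpFloor :
    ∀ K : ℝ, 0 < K → ∃ lam : ℝ, 0 < lam ∧
    ∀ (a : ℝ → E3 → E3) (θ : ℝ → E3 → ℝ) (x₀ : E3) (T r : ℝ), 0 < r →
    ∀ U : Set E3, IsOpen U → Metric.closedBall x₀ ((3 + 8 * K) * r) ⊆ U →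
    IsDriftHeatSolutionOn a θ (Real.sqrt 2 * K / r) (Set.Icc (T - r ^ 2) (T - r ^ 2 / 2)) U →
    (∀ t ∈ Set.Icc (T - r ^ 2) (T - r ^ 2 / 2), ∀ x : E3, 0 ≤ θ t x) →
    (∀ x ∈ Metric.closedBall x₀ (r / 2), θ (T - r ^ 2) x = 1) →
    ∀ x ∈ Metric.closedBall x₀ (r / 2), lam ≤ θ (T - r ^ 2 / 2) x :=
  Summit.NavierStokesRegularity.NavierStokesRegularity.Theorems.stub_driftHeatBumpFloor

/-- **Stub F (assembly, held by the lead) — the bounded-drift floor under a Type-I bound from the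
three pieces (true; M).** From F1-sig, F2-sig, F3-sig: for every `K > 0` there is `c₁ = c₁(K) > 0`
(`c₁ = λ(K)/3`) such that at a point `(T, x₀)` where a classical solution on `[0,T)` obeys the
Type-I(K) velocity bound on `(T - r₁², T) × B(x₀, r₁)`, for all `r < r₂ := min (r₁/(4+8K)) (√T)`
every MIX-admissible scalar with bump datum keeps strictly more than the fraction `c₁²` of its
`L²` mass: on the window `√(T−t) ≥ r/√2` gives the drift bound `√2 K / r` on `B(x₀, r₁)`; `u` is
continuous on `S × ℝ³` (`S ⊆ [0,T)` as `r² < T`); F1 gives class membership, F2 gives `θ ≥ 0`, F3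
gives `θ(T − r²/2) ≥ λ` on `B̄(x₀, r/2)`; `θ(T−r²/2)²` is integrable (uniform rapid decay, `n = 0`,
`K = 2`), so `∫ θ(T−r²/2)² ≥ λ² vol B̄_{r/2} = λ² vol(B₁) r³/8 > (λ²/9) vol(B₁) r³ ≥ c₁² ∫ θ(T−r²)²`
(`0 ≤ θ₀ ≤ 1`, `supp θ₀ ⊆ B_r`). Leans on: Mathlib `Measure.addHaar_ball`,
`setIntegral_le_integral`, `HasUniformRapidDecayOn` (n = 0). -/
theorem stub_typeIFloorAssembly :
    (∀ (T r : ℝ) (u : ℝ → E3 → E3) (θ : ℝ → E3 → ℝ), 0 < r →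
      ContinuousOn (Function.uncurry u) (Set.Icc (T - r ^ 2) (T - r ^ 2 / 2) ×ˢ Set.univ) →
      IsSmoothSpaceTimeOn (Set.Icc (T - r ^ 2) (T - r ^ 2 / 2)) θ →
      (∀ t ∈ Set.Icc (T - r ^ 2) (T - r ^ 2 / 2), ∀ x : E3,
        timeDerivWithin (Set.Icc (T - r ^ 2) (T - r ^ 2 / 2)) θ t x + inner ℝ (u t x) (gradient (θ t) x)
          = Laplacian.laplacian (θ t) x) →
      ∀ (A : ℝ) (U : Set E3), (∀ t ∈ Set.Icc (T - r ^ 2) (T - r ^ 2 / 2), ∀ x ∈ U, ‖u t x‖ ≤ A) →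
      ∃ a : ℝ → E3 → E3, IsDriftHeatSolutionOn a θ A (Set.Icc (T - r ^ 2) (T - r ^ 2 / 2)) U) →
    (∀ (T r : ℝ) (u : ℝ → E3 → E3) (θ : ℝ → E3 → ℝ), 0 < r →
      IsSmoothSpaceTimeOn (Set.Icc (T - r ^ 2) (T - r ^ 2 / 2)) θ →
      HasUniformRapidDecayOn (Set.Icc (T - r ^ 2) (T - r ^ 2 / 2)) θ →
      (∀ t ∈ Set.Icc (T - r ^ 2) (T - r ^ 2 / 2), ∀ x : E3,
        timeDerivWithin (Set.Icc (T - r ^ 2) (T - r ^ 2 / 2)) θ t x + inner ℝ (u t x) (gradient (θ t) x)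
          = Laplacian.laplacian (θ t) x) →
      (∀ x : E3, 0 ≤ θ (T - r ^ 2) x) →
      ∀ t ∈ Set.Icc (T - r ^ 2) (T - r ^ 2 / 2), ∀ x : E3, 0 ≤ θ t x) →
    (∀ K : ℝ, 0 < K → ∃ lam : ℝ, 0 < lam ∧
      ∀ (a : ℝ → E3 → E3) (θ : ℝ → E3 → ℝ) (x₀ : E3) (T r : ℝ), 0 < r →
      ∀ U : Set E3, IsOpen U → Metric.closedBall x₀ ((3 + 8 * K) * r) ⊆ U →
      IsDriftHeatSolutionOn a θ (Real.sqrt 2 * K / r) (Set.Icc (T - r ^ 2) (T - r ^ 2 / 2)) U →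
      (∀ t ∈ Set.Icc (T - r ^ 2) (T - r ^ 2 / 2), ∀ x : E3, 0 ≤ θ t x) →
      (∀ x ∈ Metric.closedBall x₀ (r / 2), θ (T - r ^ 2) x = 1) →
      ∀ x ∈ Metric.closedBall x₀ (r / 2), lam ≤ θ (T - r ^ 2 / 2) x) →
    ∀ K : ℝ, 0 < K → ∃ c₁ : ℝ, 0 < c₁ ∧
    ∀ (T : ℝ) (u : ℝ → E3 → E3) (p : ℝ → E3 → ℝ), 0 < T →
    IsClassicalNSSolutionOn (Set.Ico 0 T) 1 0 u p → ∀ x₀ : E3,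
    (∃ r₁ : ℝ, 0 < r₁ ∧ ∀ t ∈ Set.Ioo (T - r₁ ^ 2) T, ∀ x ∈ Metric.ball x₀ r₁,
      Real.sqrt (T - t) * ‖u t x‖ ≤ K) →
    ∃ r₂ : ℝ, 0 < r₂ ∧ ∀ r ∈ Set.Ioo 0 r₂, ∀ θ : ℝ → E3 → ℝ,
      IsSmoothSpaceTimeOn (Set.Icc (T - r ^ 2) (T - r ^ 2 / 2)) θ →
      HasUniformRapidDecayOn (Set.Icc (T - r ^ 2) (T - r ^ 2 / 2)) θ →
      (∀ t ∈ Set.Icc (T - r ^ 2) (T - r ^ 2 / 2), ∀ x : E3,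
        timeDerivWithin (Set.Icc (T - r ^ 2) (T - r ^ 2 / 2)) θ t x + inner ℝ (u t x) (gradient (θ t) x)
          = Laplacian.laplacian (θ t) x) →
      (∀ x, 0 ≤ θ (T - r ^ 2) x) → (∀ x, θ (T - r ^ 2) x ≤ 1) →
      (∀ x ∈ Metric.closedBall x₀ (r / 2), θ (T - r ^ 2) x = 1) →
      Function.support (θ (T - r ^ 2)) ⊆ Metric.ball x₀ r →
      c₁ ^ 2 * ∫ x, (θ (T - r ^ 2) x) ^ 2 < ∫ x, (θ (T - r ^ 2 / 2) x) ^ 2 :=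
  Summit.NavierStokesRegularity.NavierStokesRegularity.Theorems.stub_typeIFloorAssembly

/-- **F — the bounded-drift floor under a Type-I bound** (`stub_typeIFloor` of the birth skeleton,
now reduced to F1 + F2 + F3 + the lead's assembly stub): for every `K > 0` there is `c₁(K) > 0` such
that at a Type-I(K) point of a classical solution, for all small `r`, every MIX-admissible scalar
with bump datum satisfies `c₁² ∫ θ(T − r²)² < ∫ θ(T − r²/2)²`. -/
theorem typeIFloor :
    ∀ K : ℝ, 0 < K → ∃ c₁ : ℝ, 0 < c₁ ∧
    ∀ (T : ℝ) (u : ℝ → E3 → E3) (p : ℝ → E3 → ℝ), 0 < T →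
    IsClassicalNSSolutionOn (Set.Ico 0 T) 1 0 u p → ∀ x₀ : E3,
    (∃ r₁ : ℝ, 0 < r₁ ∧ ∀ t ∈ Set.Ioo (T - r₁ ^ 2) T, ∀ x ∈ Metric.ball x₀ r₁,
      Real.sqrt (T - t) * ‖u t x‖ ≤ K) →
    ∃ r₂ : ℝ, 0 < r₂ ∧ ∀ r ∈ Set.Ioo 0 r₂, ∀ θ : ℝ → E3 → ℝ,
      IsSmoothSpaceTimeOn (Set.Icc (T - r ^ 2) (T - r ^ 2 / 2)) θ →
      HasUniformRapidDecayOn (Set.Icc (T - r ^ 2) (T - r ^ 2 / 2)) θ →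
      (∀ t ∈ Set.Icc (T - r ^ 2) (T - r ^ 2 / 2), ∀ x : E3,
        timeDerivWithin (Set.Icc (T - r ^ 2) (T - r ^ 2 / 2)) θ t x + inner ℝ (u t x) (gradient (θ t) x)
          = Laplacian.laplacian (θ t) x) →
      (∀ x, 0 ≤ θ (T - r ^ 2) x) → (∀ x, θ (T - r ^ 2) x ≤ 1) →
      (∀ x ∈ Metric.closedBall x₀ (r / 2), θ (T - r ^ 2) x = 1) →
      Function.support (θ (T - r ^ 2)) ⊆ Metric.ball x₀ r →
      c₁ ^ 2 * ∫ x, (θ (T - r ^ 2) x) ^ 2 < ∫ x, (θ (T - r ^ 2 / 2) x) ^ 2 :=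
  stub_typeIFloorAssembly stub_admissibleDriftHeatClass stub_admissibleMinPrinciple
    stub_driftHeatBumpFloor

/-! ## H — the open heart -/

/-- **Stub H — self-mixing forces at most Type-I velocity growth (the OPEN HEART of P; XL/open).**
There are absolute `δ > 0` and `K > 0` such that every standing solution that is cofinally
`δ`-mixing at `(T, x₀)` (`DissipatesAtScale u T x₀ r δ` for all `r ∈ (0, r₀)`) obeys the
Type-I(K) velocity bound `√(T − t)‖u(t,x)‖ ≤ K` on some parabolic cylinder at `(T, x₀)`. At points
near which `u` is bounded the conclusion is free (shrink `r₁`), and for `δ` below the floor of F the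
hypothesis is unsatisfiable at Type-I(K) points, so H ⇔ P modulo W + F: its content is **no
blow-up with unbounded Type-I ratio is cofinally `δ`-self-mixing at the parabolic scales**.
Consistency (refuter's mass export): `δ`-mixing at scale `r` needs `|u| ≳ δ^{-2/3}/r` on the
window, so `K ≳ δ^{-2/3}`. Why it might fail: a super-Type-I drift can mix; finite energy gives no
a priori bound on the Type-I ratio (`Literature.Barriers.NavierStokesRegularity.EnergySupercriticality`),
so H is refutable exactly by a cofinally-mixing Type-II blow-up, the route's own kill criterion for P.
Sources: ConstantinEtAl2008, Zlatos2010, FengIyer2019, Seregin2014Notes, AlbrittonBarker2019,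
KiselevXu2016, IyerXuZlatos2021. -/
theorem stub_mixingForcesTypeI :
    ∃ δ : ℝ, 0 < δ ∧ ∃ K : ℝ, 0 < K ∧
    ∀ (T : ℝ) (u : ℝ → E3 → E3) (p : ℝ → E3 → ℝ), 0 < T →
    IsClassicalNSSolutionOn (Set.Ico 0 T) 1 0 u p → IsLerayHopfOn T 1 0 (u 0) u →
    HasRapidSpatialDecay (u 0) → ∀ x₀ : E3,
    (∃ r₀ : ℝ, 0 < r₀ ∧ ∀ r ∈ Set.Ioo 0 r₀, DissipatesAtScale u T x₀ r δ) →
    ∃ r₁ : ℝ, 0 < r₁ ∧ ∀ t ∈ Set.Ioo (T - r₁ ^ 2) T, ∀ x ∈ Metric.ball x₀ r₁,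
      Real.sqrt (T - t) * ‖u t x‖ ≤ K := by
  sorry

/-! ## The assembly (kernel-checked, sorry-free): W → F → H → the crux statement -/

/-- **Composition with explicit hypotheses** (`W-sig → F-sig → H-sig → crux`; the conclusion is the
crux's body VERBATIM — `MixingPayoff` unfolds to it by `rfl`). Sorry-free, standard axioms. Take
`δ_H, K` from H and `c₁ = c₁(K)` from F, put `δ* := min δ_H (c₁/2)`. Given cofinal `δ*`-mixing at
`(T, x₀)`: monotonicity of `DissipatesAtScale` in the factor gives cofinal `δ_H`-mixing, H gives
Type-I(K), F gives a floor scale `r₂`; at a scale `r < min r₀ r₂` with `r² < T`, W produces the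
admissible scalar `θ` from the `ContDiffBump` datum centred at `x₀` (`rIn = r/2`, `rOut = r`);
`MIX(r, δ*)` says `∫ θ(T-r²/2)² ≤ δ*² ∫ θ(T-r²)²` while F says `c₁² ∫ θ(T-r²)² < ∫ θ(T-r²/2)²`, and
`δ*² ≤ c₁²`: contradiction, hence `BDD`. -/
theorem mixingPayoff_of_WFH
    (hW : ∀ (T : ℝ) (u : ℝ → E3 → E3) (p : ℝ → E3 → ℝ), 0 < T →
      IsClassicalNSSolutionOn (Set.Ico 0 T) 1 0 u p → IsLerayHopfOn T 1 0 (u 0) u →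
      HasRapidSpatialDecay (u 0) →
      ∀ r : ℝ, 0 < r → r ^ 2 < T →
      ∀ θ₀ : E3 → ℝ, ContDiff ℝ ∞ θ₀ → HasCompactSupport θ₀ →
      ∃ θ : ℝ → E3 → ℝ,
        IsSmoothSpaceTimeOn (Set.Icc (T - r ^ 2) (T - r ^ 2 / 2)) θ ∧
        HasUniformRapidDecayOn (Set.Icc (T - r ^ 2) (T - r ^ 2 / 2)) θ ∧
        (∀ t ∈ Set.Icc (T - r ^ 2) (T - r ^ 2 / 2), ∀ x : E3,
          timeDerivWithin (Set.Icc (T - r ^ 2) (T - r ^ 2 / 2)) θ t x + inner ℝ (u t x) (gradient (θ t) x)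
            = Laplacian.laplacian (θ t) x) ∧
        θ (T - r ^ 2) = θ₀)
    (hF : ∀ K : ℝ, 0 < K → ∃ c₁ : ℝ, 0 < c₁ ∧
      ∀ (T : ℝ) (u : ℝ → E3 → E3) (p : ℝ → E3 → ℝ), 0 < T →
      IsClassicalNSSolutionOn (Set.Ico 0 T) 1 0 u p → ∀ x₀ : E3,
      (∃ r₁ : ℝ, 0 < r₁ ∧ ∀ t ∈ Set.Ioo (T - r₁ ^ 2) T, ∀ x ∈ Metric.ball x₀ r₁,
        Real.sqrt (T - t) * ‖u t x‖ ≤ K) →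
      ∃ r₂ : ℝ, 0 < r₂ ∧ ∀ r ∈ Set.Ioo 0 r₂, ∀ θ : ℝ → E3 → ℝ,
        IsSmoothSpaceTimeOn (Set.Icc (T - r ^ 2) (T - r ^ 2 / 2)) θ →
        HasUniformRapidDecayOn (Set.Icc (T - r ^ 2) (T - r ^ 2 / 2)) θ →
        (∀ t ∈ Set.Icc (T - r ^ 2) (T - r ^ 2 / 2), ∀ x : E3,
          timeDerivWithin (Set.Icc (T - r ^ 2) (T - r ^ 2 / 2)) θ t x + inner ℝ (u t x) (gradient (θ t) x)
            = Laplacian.laplacian (θ t) x) →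
        (∀ x, 0 ≤ θ (T - r ^ 2) x) → (∀ x, θ (T - r ^ 2) x ≤ 1) →
        (∀ x ∈ Metric.closedBall x₀ (r / 2), θ (T - r ^ 2) x = 1) →
        Function.support (θ (T - r ^ 2)) ⊆ Metric.ball x₀ r →
        c₁ ^ 2 * ∫ x, (θ (T - r ^ 2) x) ^ 2 < ∫ x, (θ (T - r ^ 2 / 2) x) ^ 2)
    (hH : ∃ δ : ℝ, 0 < δ ∧ ∃ K : ℝ, 0 < K ∧
      ∀ (T : ℝ) (u : ℝ → E3 → E3) (p : ℝ → E3 → ℝ), 0 < T →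
      IsClassicalNSSolutionOn (Set.Ico 0 T) 1 0 u p → IsLerayHopfOn T 1 0 (u 0) u →
      HasRapidSpatialDecay (u 0) → ∀ x₀ : E3,
      (∃ r₀ : ℝ, 0 < r₀ ∧ ∀ r ∈ Set.Ioo 0 r₀, DissipatesAtScale u T x₀ r δ) →
      ∃ r₁ : ℝ, 0 < r₁ ∧ ∀ t ∈ Set.Ioo (T - r₁ ^ 2) T, ∀ x ∈ Metric.ball x₀ r₁,
        Real.sqrt (T - t) * ‖u t x‖ ≤ K) :
    -- the body of `MixingPayoff`, verbatim from the route file: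
    ∃ δ : ℝ, 0 < δ ∧ ∀ T : ℝ, 0 < T → ∀ (u : ℝ → EuclideanSpace ℝ (Fin 3) → EuclideanSpace ℝ (Fin 3)) (p : ℝ → EuclideanSpace ℝ (Fin 3) → ℝ), Literature.Analysis.FluidPDE.IsClassicalNSSolutionOn (Set.Ico 0 T) 1 0 u p → Literature.Analysis.FluidPDE.IsLerayHopfOn T 1 0 (u 0) u → Literature.Analysis.FluidPDE.HasRapidSpatialDecay (u 0) → ∀ x₀ : EuclideanSpace ℝ (Fin 3), (∃ r₀ : ℝ, 0 < r₀ ∧ ∀ r ∈ Set.Ioo 0 r₀, (∀ θ : ℝ → EuclideanSpace ℝ (Fin 3) → ℝ, Literature.Analysis.FluidPDE.IsSmoothSpaceTimeOn (Set.Icc (T - r ^ 2) (T - r ^ 2 / 2)) θ → Literature.Analysis.FluidPDE.HasUniformRapidDecayOn (Set.Icc (T - r ^ 2) (T - r ^ 2 / 2)) θ → (∀ t ∈ (Set.Icc (T - r ^ 2) (T - r ^ 2 / 2)), ∀ x : EuclideanSpace ℝ (Fin 3), Literature.Analysis.FluidPDE.timeDerivWithin (Set.Icc (T - r ^ 2)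 (T - r ^ 2 / 2)) θ t x + inner ℝ (u t x) (gradient (θ t) x) = Laplacian.laplacian (θ t) x) → Function.support (θ (T - r ^ 2)) ⊆ Metric.ball x₀ r → ∫ x, (θ (T - r ^ 2 / 2) x) ^ 2 ≤ δ ^ 2 * ∫ x, (θ (T - r ^ 2) x) ^ 2)) → (∃ ρ : ℝ, 0 < ρ ∧ ∃ M : ℝ, ∀ t ∈ Set.Ioo (T - ρ ^ 2) T, ∀ x ∈ Metric.ball x₀ ρ, ‖u t x‖ ≤ M) := by
  obtain ⟨δH, hδH, K, hK, hH⟩ := hH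
  obtain ⟨c₁, hc₁, hF⟩ := hF K hK
  have hδpos : 0 < min δH (c₁ / 2) := lt_min hδH (by positivity)
  refine ⟨min δH (c₁ / 2), hδpos, ?_⟩
  intro T hT u p hcl hLH hdec x₀ hmix
  obtain ⟨r₀, hr₀, hmix⟩ := hmix
  -- Step 1 (H): cofinal `δ*`-mixing ⇒ cofinal `δ_H`-mixing (monotonicity) ⇒ Type-I(K).
  have hTI : ∃ r₁ : ℝ, 0 < r₁ ∧ ∀ t ∈ Set.Ioo (T - r₁ ^ 2) T, ∀ x ∈ Metric.ball x₀ r₁,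
      Real.sqrt (T - t) * ‖u t x‖ ≤ K := by
    refine hH T u p hT hcl hLH hdec x₀ ⟨r₀, hr₀, fun r hr => ?_⟩
    have h : DissipatesAtScale u T x₀ r (min δH (c₁ / 2)) := hmix r hr
    exact h.mono hδpos.le (min_le_left _ _)
  -- Step 2 (F): the floor scale `r₂` below which bump data keep the fraction `c₁²`.
  obtain ⟨r₂, hr₂, hfl⟩ := hF T u p hT hcl x₀ hTI
  -- Step 3: a scale `r` below `r₀`, `r₂` and with `r² < T`.
  obtain ⟨r, hr, hrr₀, hrr₂, hrT⟩ : ∃ r : ℝ, 0 < r ∧ r < r₀ ∧ r < r₂ ∧ r ^ 2 < T := by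
    have hm : 0 < min (min r₀ r₂) (Real.sqrt T) :=
      lt_min (lt_min hr₀ hr₂) (Real.sqrt_pos.2 hT)
    have h₁ : min (min r₀ r₂) (Real.sqrt T) ≤ r₀ := (min_le_left _ _).trans (min_le_left _ _)
    have h₂ : min (min r₀ r₂) (Real.sqrt T) ≤ r₂ := (min_le_left _ _).trans (min_le_right _ _)
    have h₃ : min (min r₀ r₂) (Real.sqrt T) ≤ Real.sqrt T := min_le_right _ _
    have hsq : Real.sqrt T ^ 2 = T := Real.sq_sqrt hT.le
    refine ⟨min (min r₀ r₂) (Real.sqrt T) / 2, by positivity, by linarith, by linarith, ?_⟩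
    nlinarith [Real.sqrt_nonneg T]
  -- Step 4 (W): the admissible scalar launched by the bump datum centred at `x₀`.
  let φ : ContDiffBump x₀ := ⟨r / 2, r, by positivity, by linarith⟩
  obtain ⟨θ, hsm, hdecay, hpde, hθ₀⟩ :=
    hW T u p hT hcl hLH hdec r hr hrT φ φ.contDiff φ.hasCompactSupport
  have hsupp : Function.support (θ (T - r ^ 2)) ⊆ Metric.ball x₀ r := by
    rw [hθ₀, φ.support_eq]
  -- Step 5: `MIX(r, δ*)` on `θ` versus the floor on `θ`.
  have hM : ∫ x, (θ (T - r ^ 2 / 2) x) ^ 2 ≤ (min δH (c₁ / 2)) ^ 2 * ∫ x, (θ (T - r ^ 2) x) ^ 2 :=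
    hmix r ⟨hr, hrr₀⟩ θ hsm hdecay hpde hsupp
  have hL : c₁ ^ 2 * ∫ x, (θ (T - r ^ 2) x) ^ 2 < ∫ x, (θ (T - r ^ 2 / 2) x) ^ 2 :=
    hfl r ⟨hr, hrr₂⟩ θ hsm hdecay hpde
      (fun x => by rw [hθ₀]; exact φ.nonneg)
      (fun x => by rw [hθ₀]; exact φ.le_one)
      (fun x hx => by rw [hθ₀]; exact φ.one_of_mem_closedBall hx)
      hsupp
  have hX : 0 ≤ ∫ x, (θ (T - r ^ 2) x) ^ 2 := integral_nonneg fun _ => sq_nonneg _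
  have hδc : (min δH (c₁ / 2)) ^ 2 ≤ c₁ ^ 2 :=
    pow_le_pow_left₀ hδpos.le ((min_le_right _ _).trans (by linarith)) 2
  have hlt : c₁ ^ 2 * ∫ x, (θ (T - r ^ 2) x) ^ 2 < c₁ ^ 2 * ∫ x, (θ (T - r ^ 2) x) ^ 2 :=
    hL.trans_le (hM.trans (mul_le_mul_of_nonneg_right hδc hX))
  exact absurd hlt (lt_irrefl _)

/-- **THE SKELETON THEOREM.** The crux
`Summit.NavierStokesRegularity.NavierStokesRegularity.Theses.SelfMixingDichotomy.MixingPayoff`,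
concluded BY NAME from W (`scalarSlabWellposed` ← stubs W1, W2), F (`typeIFloor` ← stubs F1, F2,
F3, F) and the stub H through the sorry-free composition `mixingPayoff_of_WFH` (`MixingPayoff` is
that statement by `rfl`). -/
theorem MixingPayoff_of : MixingPayoff :=
  mixingPayoff_of_WFH scalarSlabWellposed typeIFloor stub_mixingForcesTypeI

end Summit.NavierStokesRegularity.NavierStokesRegularity.Cruxes.MixingPayoff.Birth

end
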